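import Literature.NumberTheory.GaloisRepresentations.DegreeOnePrimesFrobeniusRel
import Literature.NumberTheory.GaloisRepresentations.CyclotomicFrobenius
import HarnessLib

/-!
# Deuring's reduction over an arbitrary base, counted in the `galFrob` language

Topic `Summits/QuantumAdvantage/QuantumAdvantage/Theorems`, cell B2b-1 (linnik-cubic), PART A (gen 16); helper
toward the crux `DegreeOnePrimesEscape` (stmt-QuantumAdvantage-11543) — the counting lemma for the Chebotarev
prime number theorem over an ARBITRARY base field `F` (`…ConjClassPNTRelative.lean`).  HONEST FRAMING: the
value of this file is a THEOREM (kernel-checked prime bookkeeping) — NOT summit progress.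

`…ConjClassCount.lean` (gen 13) is Deuring's count for `N/ℚ`; the Literature holds the relative identity
`DegreeOnePrimesRel.card_mul_card_frob_eq_card_conj_eq` (base any number field `F`) in the language "every
arithmetic Frobenius over `𝓞_F` at every prime above `P'` equals `h`".  The analytic side of the cell
(`frobeniusPsi_dichotomy_signed_all`) speaks the `galFrob E N` language of `CyclotomicFrobenius.lean`.  This
file is the dictionary between the two and the resulting count:

* `frobCondition_iff_galFrob` — for `F ⊆ E ⊆ N`, `N/F` Galois, `Gal(N/E)` abelian, `q` a prime of `F` with
  `N q = p` prime, unramified in `N`, `h ∈ Gal(N/E)` and `P' ∣ q` a prime of `E`: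
  `(f(P'|q) = 1 ∧ every Frobenius over 𝓞_F at every prime of N above P' is h) ↔ (N P' = p ∧ Frob_{N/E}(P') = h)`;
* `card_aut_mul_card_degOneFrobPrimes_eq_relative` — **Deuring's count over `F`**:
  `|Gal(N/E)| · #{P' ∣ q in E : N P' = p, Frob_{N/E}(P') = τ} = #{g ∈ Gal(N/F) : g φ g⁻¹ = τ}`
  for any arithmetic Frobenius `φ` of `N/F` above `q`.
  [cite: LagariasMontgomeryOdlyzko1979, §3 (Deuring's reduction)]; [NeukirchANT1999, VII (13.4)].
-/

noncomputable section

open Ideal NumberField MulAction IsDedekindDomain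
open scoped Pointwise NumberField Classical

namespace Summit.QuantumAdvantage.QuantumAdvantage.Theorems.DegreeOnePrimesEscape

open Literature.NumberTheory.GaloisRepresentations

variable {F N : Type} [Field F] [NumberField F] [Field N] [NumberField N] [Algebra F N] [IsGalois F N]

omit [NumberField F] [NumberField N] [IsGalois F N] in
/-- The identification `Gal(N/E) ≅ H ≤ Gal(N/F)` is compatible with the actions on `𝓞 N`. [folklore] -/
theorem fixingSubgroupEquiv_smul_rel (E : IntermediateField F N) (τ : E.fixingSubgroup) (x : 𝓞 N) :
    (IntermediateField.fixingSubgroupEquiv E τ) • x = (τ : N ≃ₐ[F] N) • x :=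
  Subtype.ext rfl

omit [NumberField F] [NumberField N] [IsGalois F N] in
/-- Restricting scalars does not change the Galois action on `𝓞 N`. [folklore] -/
theorem restrictScalars_smul_rel (E : IntermediateField F N) (ψ : N ≃ₐ[E] N) (x : 𝓞 N) :
    (ψ.restrictScalars F) • x = ψ • x :=
  Subtype.ext rfl

omit [NumberField F] [NumberField N] [IsGalois F N] in
/-- `(fixingSubgroupEquiv E τ).restrictScalars F = τ`. [folklore] -/
theorem restrictScalars_fixingSubgroupEquiv (E : IntermediateField F N) (τ : E.fixingSubgroup) :
    (IntermediateField.fixingSubgroupEquiv E τ).restrictScalars F = (τ : N ≃ₐ[F] N) :=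
  AlgEquiv.ext fun _ => rfl

/-- **A Frobenius over `𝓞_E` at a prime above a degree-one `P' ∣ q` is a Frobenius over `𝓞_F`.**  If `Q ∣ P' ∣ q`
with `#(𝓞_E/P') = #(𝓞_F/q)` and `ψ ∈ Gal(N/E)` satisfies `ψ x ≡ x^{N P'} (mod Q)`, then `ψ x ≡ x^{N q} (mod Q)`. -/
theorem isArithFrobAt_restrictScalars_of_card_eq (E : IntermediateField F N) {q : Ideal (𝓞 F)}
    {Q : Ideal (𝓞 N)} [Q.LiesOver q] (hcard : Nat.card (𝓞 E ⧸ Q.under (𝓞 E)) = Nat.card (𝓞 F ⧸ q))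
    {ψ : N ≃ₐ[E] N} (hψ : IsArithFrobAt (𝓞 E) ψ Q) : IsArithFrobAt (𝓞 F) (ψ.restrictScalars F) Q := by
  intro x
  have h1 := hψ x
  rw [hcard, over_def Q q, MulSemiringAction.toAlgHom_apply] at h1
  rw [MulSemiringAction.toAlgHom_apply, restrictScalars_smul_rel]
  exact h1

/-- **The dictionary.**  `F ⊆ E ⊆ N`, `N/F` Galois, `Gal(N/E)` abelian; `q` a prime of `F` unramified in `N` with
`N q = p` prime; `h ∈ Gal(N/E) ≤ Gal(N/F)`; `P' ∣ q` a prime of `E`, `v` the corresponding point of `Spec 𝓞_E`.  Then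
"`f(P'|q) = 1` and every arithmetic Frobenius of `N/F` at every prime above `P'` equals `h`" iff
"`N P' = p` and `galFrob E N v = h`". [cite: NeukirchANT1999, VII (13.4)] -/
theorem frobCondition_iff_galFrob (E : IntermediateField F N) (hcomm : ∀ a b : N ≃ₐ[E] N, Commute a b)
    {q : HeightOneSpectrum (𝓞 F)} (hunr : Algebra.IsUnramifiedIn (𝓞 N) q.asIdeal)
    {p : ℕ} (hp : p.Prime) (hq : absNorm q.asIdeal = p)
    {h : N ≃ₐ[F] N} (hh : h ∈ E.fixingSubgroup)
    (v : HeightOneSpectrum (𝓞 E)) (hv : v.asIdeal ∈ q.asIdeal.primesOver (𝓞 E)) :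
    (v.asIdeal.inertiaDeg (𝓞 F) = 1 ∧ ∀ Q : Ideal (𝓞 N), Q.IsPrime → Q.LiesOver v.asIdeal →
        ∀ σ : N ≃ₐ[F] N, IsArithFrobAt (𝓞 F) σ Q → σ = h) ↔
      (absNorm v.asIdeal = p ∧ galFrob E N v = IntermediateField.fixingSubgroupEquiv E ⟨h, hh⟩) := by
  haveI : q.asIdeal.IsMaximal := q.isMaximal
  haveI := hv.2
  haveI : v.asIdeal.IsMaximal := v.isMaximal
  haveI : IsGaloisGroup (N ≃ₐ[E] N) (𝓞 E) (𝓞 N) := IsGaloisGroup.of_isFractionRing _ _ _ E N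
  set τ' : N ≃ₐ[E] N := IntermediateField.fixingSubgroupEquiv E ⟨h, hh⟩ with hτ'
  -- cardinalities
  have hcardq : Nat.card (𝓞 F ⧸ q.asIdeal) = p := by
    rw [← Submodule.cardQuot_apply, ← Ideal.absNorm_apply, hq]
  have hcardv : Nat.card (𝓞 E ⧸ v.asIdeal) = absNorm v.asIdeal := by
    rw [← Submodule.cardQuot_apply, ← Ideal.absNorm_apply]
  have hpow : p ^ v.asIdeal.inertiaDeg (𝓞 F) = absNorm v.asIdeal := by
    rw [← hq]; exact Ideal.absNorm_pow_inertiaDeg q.asIdeal v.asIdeal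
  have hf_iff : v.asIdeal.inertiaDeg (𝓞 F) = 1 ↔ absNorm v.asIdeal = p := by
    constructor
    · intro hf; rw [← hpow, hf, pow_one]
    · intro hN
      rw [hN] at hpow
      exact Nat.pow_right_injective hp.two_le (by change p ^ _ = p ^ 1; rw [hpow, pow_one])
  -- the chosen Frobenius of `N/E` above `v`
  obtain ⟨Q₁, hQ₁, hfrob₁⟩ := galFrob_spec E N v
  haveI := hQ₁.1
  haveI := hQ₁.2
  haveI : Q₁.LiesOver q.asIdeal := LiesOver.trans Q₁ v.asIdeal q.asIdeal
  have hQ₁q : Q₁ ∈ q.asIdeal.primesOver (𝓞 N) := ⟨hQ₁.1, inferInstance⟩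
  -- every prime of `N` above `v` lies above `q`, and carries `galFrob E N v` as an `𝓞_E`-Frobenius
  have hall : ∀ Q : Ideal (𝓞 N), Q.IsPrime → Q.LiesOver v.asIdeal → IsArithFrobAt (𝓞 E) (galFrob E N v) Q := by
    intro Q hQp hQl
    haveI := hQp
    haveI := hQl
    obtain ⟨g, hg⟩ := Ideal.exists_smul_eq_of_isGaloisGroup v.asIdeal Q₁ Q (N ≃ₐ[E] N)
    have h2 := hfrob₁.conj g
    rw [hg, (hcomm g (galFrob E N v)).eq, mul_inv_cancel_right] at h2
    exact h2
  constructor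
  · rintro ⟨hf, hσ⟩
    have hN : absNorm v.asIdeal = p := hf_iff.mp hf
    refine ⟨hN, ?_⟩
    -- `galFrob E N v`, restricted to `F`, is an `𝓞_F`-Frobenius at `Q₁`, hence equals `h`
    have hcard : Nat.card (𝓞 E ⧸ Q₁.under (𝓞 E)) = Nat.card (𝓞 F ⧸ q.asIdeal) := by
      rw [← hQ₁.2.over, hcardv, hN, hcardq]
    have hres : IsArithFrobAt (𝓞 F) ((galFrob E N v).restrictScalars F) Q₁ :=
      isArithFrobAt_restrictScalars_of_card_eq E hcard hfrob₁
    have heq : (galFrob E N v).restrictScalars F = h := hσ Q₁ hQ₁.1 hQ₁.2 _ hres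
    apply (IntermediateField.fixingSubgroupEquiv E).symm.injective
    apply Subtype.ext
    rw [MulEquiv.symm_apply_apply]
    change ((IntermediateField.fixingSubgroupEquiv E).symm (galFrob E N v) : N ≃ₐ[F] N) = h
    rw [← heq, ← restrictScalars_fixingSubgroupEquiv E, MulEquiv.apply_symm_apply]
  · rintro ⟨hN, hgal⟩
    refine ⟨hf_iff.mpr hN, fun Q hQp hQl σ hσ => ?_⟩
    haveI := hQp
    haveI := hQl
    haveI : Q.LiesOver q.asIdeal := LiesOver.trans Q v.asIdeal q.asIdeal
    have hQq : Q ∈ q.asIdeal.primesOver (𝓞 N) := ⟨hQp, inferInstance⟩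
    have hcard : Nat.card (𝓞 E ⧸ Q.under (𝓞 E)) = Nat.card (𝓞 F ⧸ q.asIdeal) := by
      rw [← hQl.over, hcardv, hN, hcardq]
    have hres : IsArithFrobAt (𝓞 F) ((galFrob E N v).restrictScalars F) Q :=
      isArithFrobAt_restrictScalars_of_card_eq E hcard (hall Q hQp hQl)
    rw [hgal, restrictScalars_fixingSubgroupEquiv] at hres
    exact eq_of_isArithFrobAt_of_isUnramifiedIn hunr hQq hσ hres

/-- **Deuring's count over an arbitrary base** (see the module docstring): `F ⊆ E ⊆ N`, `N/F` Galois,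
`Gal(N/E)` abelian, `q` a prime of `F` unramified in `N` with `N q = p` prime, `φ` an arithmetic Frobenius of
`N/F` at some prime above `q`, `τ ∈ Gal(N/E)`:
`|Gal(N/E)| · #{P' ∣ q prime of E : N P' = p, Frob_{N/E}(P') = τ} = #{g ∈ Gal(N/F) : g φ g⁻¹ = τ}`.
[cite: LagariasMontgomeryOdlyzko1979, §3] [cite: NeukirchANT1999, VII (13.4)] -/
theorem card_aut_mul_card_degOneFrobPrimes_eq_relative (E : IntermediateField F N)
    (hcomm : ∀ a b : N ≃ₐ[E] N, Commute a b)
    {q : HeightOneSpectrum (𝓞 F)} (hunr : Algebra.IsUnramifiedIn (𝓞 N) q.asIdeal)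
    {p : ℕ} (hp : p.Prime) (hq : absNorm q.asIdeal = p)
    {Q₀ : Ideal (𝓞 N)} (hQ₀ : Q₀ ∈ q.asIdeal.primesOver (𝓞 N))
    {φ : N ≃ₐ[F] N} (hφ : IsArithFrobAt (𝓞 F) φ Q₀) {τ : N ≃ₐ[F] N} (hτ : τ ∈ E.fixingSubgroup) :
    Nat.card (N ≃ₐ[E] N) *
      Nat.card {v : HeightOneSpectrum (𝓞 E) // v.asIdeal.LiesOver q.asIdeal ∧ absNorm v.asIdeal = p ∧
        galFrob E N v = IntermediateField.fixingSubgroupEquiv E ⟨τ, hτ⟩} =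
      Nat.card {g : N ≃ₐ[F] N // g * φ * g⁻¹ = τ} := by
  haveI : IsMulCommutative E.fixingSubgroup :=
    ⟨⟨fun a b => (IntermediateField.fixingSubgroupEquiv E).injective (by
      rw [map_mul, map_mul]; exact (hcomm _ _).eq)⟩⟩
  rw [← DegreeOnePrimesRel.card_mul_card_frob_eq_card_conj_eq E hunr hQ₀ hφ hτ,
    Nat.card_congr (IntermediateField.fixingSubgroupEquiv E).toEquiv.symm]
  congr 1
  symm
  refine Nat.card_congr
    { toFun := fun P => ⟨⟨P.1.1, P.1.2.1, ?_⟩, ?_⟩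
      invFun := fun v => ⟨⟨v.1.asIdeal, v.1.isPrime, v.2.1⟩, ?_⟩
      left_inv := fun P => by rfl
      right_inv := fun v => by rfl }
  · haveI := P.1.2.1
    haveI := P.1.2.2
    exact Ideal.ne_bot_of_mem_primesOver q.ne_bot P.1.2
  · haveI := P.1.2.2
    have h := (frobCondition_iff_galFrob E hcomm hunr hp hq hτ ⟨P.1.1, P.1.2.1,
      by haveI := P.1.2.1; exact Ideal.ne_bot_of_mem_primesOver q.ne_bot P.1.2⟩ P.1.2).mp P.2
    exact ⟨P.1.2.2, h.1, h.2⟩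
  · haveI := v.2.1
    exact (frobCondition_iff_galFrob E hcomm hunr hp hq hτ v.1 ⟨v.1.isPrime, v.2.1⟩).mpr ⟨v.2.2.1, v.2.2.2⟩

end Summit.QuantumAdvantage.QuantumAdvantage.Theorems.DegreeOnePrimesEscape

end
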